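import Literature.Barriers.AtomisticToContinuum.OneDimensionalHardCoreRodsCompress
import Literature.Barriers.AtomisticToContinuum.OneDimensionalHardCoreRodsShift
import Mathlib.MeasureTheory.Function.Jacobian
import HarnessLib

/-!
# Hard rods: the excluded-volume change of variables (tagged phase space)

`Literature/Barriers/AtomisticToContinuum/` (D-0021 barrier catalogue), sub-problem
`BoseEinsteinCondensation`; part of the typed proof of the rod barrier `OneDimensionalHardRods`
(`OneDimensionalHardCoreRods.lean`, eighth audit of `OneDimensionalHardCore`, 2026-08-16).

Faithfulness plumbing, step (1) of the paper proof, as a change of variables. On the **tagged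
phase space** `E = ℝ × ℝⁿ` of points `p = (s, X)` (displacement of the second copy of the tagged
rod, spectators), the strictly admissible configurations form the open set `U`
(`rodTaggedSet`), on which the **excluded-volume map** `Φ(s, X) = (s − ma, w)`
(`rodExcludedVolumeMap`; `m = #{j : X_j < s}`, `w_j = X_j − a(1 + srank_j)`) is locally a
translation (`hasFDerivWithinAt_rodExcludedVolumeMap`: derivative `id`) and injective
(`injOn_rodExcludedVolumeMap`: the spectator order and the crossing pattern are read off `(t, w)`,
`lt_iff_rodSpectator_lt`, `lt_iff_rodSpectator_le`). Its image lies in the compressed phase space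
`V = {(t, w) : t ∈ [0, L' + a], w ∈ D_tⁿ}` (`rodExcludedVolumeMap_mem`).

## References

* [MazzantiEtAl2008] F. Mazzanti et al., Phys. Rev. Lett. 100 (2008) 020401: Eqs. (2)–(3).
* [Nagamiya1940] T. Nagamiya, Proc. Phys.-Math. Soc. Japan 22 (1940) 705.
-/

noncomputable section

open MeasureTheory Set Filter Topology
open scoped BigOperators Real ENNReal

namespace Literature.Barriers.AtomisticToContinuum.BoseGas

variable {n : ℕ} {L a s : ℝ}

/-! #### Strict order of the spectators is preserved by compression -/

namespace RodTagged

variable {X : Fin n → ℝ}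

/-- **Strict packing between two spectators**: if `X_i < X_j` then `a · #{k : X_i ≤ X_k < X_j} < X_j − X_i`
(strict separation). [folklore] -/
theorem mul_card_Ico_lt (h : RodTagged n L a s X) (ha : 0 ≤ a) {i j : Fin n} (hij : X i < X j) :
    a * ((Finset.univ.filter fun k : Fin n => X i ≤ X k ∧ X k < X j).card : ℝ) < X j - X i := by
  classical
  set T := Finset.univ.filter fun k : Fin n => X i ≤ X k ∧ X k < X j with hT
  set Tp := Finset.univ.filter fun k : Fin n => X i < X k ∧ X k < X j with hTp
  have hsplit : T = insert i Tp := by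
    ext k
    simp only [hT, hTp, Finset.mem_filter, Finset.mem_univ, true_and, Finset.mem_insert]
    constructor
    · rintro ⟨hk1, hk2⟩
      rcases lt_or_eq_of_le hk1 with hk1 | hk1
      · exact Or.inr ⟨hk1, hk2⟩
      · left; by_contra hki; exact h.inj ha hki hk1.symm
    · rintro (rfl | ⟨hk1, hk2⟩)
      · exact ⟨le_rfl, hij⟩
      · exact ⟨hk1.le, hk2⟩
  have hiTp : i ∉ Tp := by simp [hTp]
  rw [hsplit, Finset.card_insert_of_notMem hiTp, Nat.cast_add, Nat.cast_one]
  have hsep_ij : a < X j - X i := by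
    have hne : i ≠ j := fun hij' => by rw [hij'] at hij; exact lt_irrefl _ hij
    have := h.sep i j hne
    rwa [abs_of_neg (by linarith), neg_sub] at this
  by_cases hTe : Tp = ∅
  · rw [hTe, Finset.card_empty, Nat.cast_zero, zero_add, mul_one]
    exact hsep_ij
  · have hne : Tp.Nonempty := Finset.nonempty_iff_ne_empty.mpr hTe
    have hpack := mul_card_lt_of_separated X Tp (X i + a) (X j - a)
      (fun k _ l _ hkl => (h.sep k l hkl).le)
      (fun k hk => by
        simp only [hTp, Finset.mem_filter, Finset.mem_univ, true_and] at hk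
        have hki : k ≠ i := fun hki => by rw [hki] at hk; exact lt_irrefl _ hk.1
        have hkj : k ≠ j := fun hkj => by rw [hkj] at hk; exact lt_irrefl _ hk.2
        have h1 := h.sep k i hki
        have h2 := h.sep k j hkj
        rw [abs_of_pos (by linarith [hk.1])] at h1
        rw [abs_of_neg (by linarith [hk.2])] at h2
        exact ⟨by linarith, by linarith⟩) hne
    nlinarith

/-- **Compression preserves the strict order of the spectators.** [folklore] -/
theorem rodSpectator_lt_of_lt (h : RodTagged n L a s X) (ha : 0 ≤ a) {i j : Fin n} (hij : X i < X j) :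
    rodSpectator a X i < rodSpectator a X j := by
  classical
  have hrank : (rodRank X j : ℝ) = rodRank X i +
      ((Finset.univ.filter fun k : Fin n => X i ≤ X k ∧ X k < X j).card : ℝ) := by
    have h1 : (Finset.univ.filter fun k : Fin n => X k < X j) =
        (Finset.univ.filter fun k : Fin n => X k < X i) ∪
          (Finset.univ.filter fun k : Fin n => X i ≤ X k ∧ X k < X j) := by
      ext k
      simp only [Finset.mem_filter, Finset.mem_univ, true_and, Finset.mem_union]
      constructor
      · intro hk
        by_cases hki : X k < X i
        · exact Or.inl hki
        · exact Or.inr ⟨not_lt.mp hki, hk⟩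
      · rintro (hk | ⟨_, hk⟩)
        · exact hk.trans hij
        · exact hk
    have h2 : Disjoint (Finset.univ.filter fun k : Fin n => X k < X i)
        (Finset.univ.filter fun k : Fin n => X i ≤ X k ∧ X k < X j) := by
      rw [Finset.disjoint_left]; intro k hk hk'
      simp only [Finset.mem_filter, Finset.mem_univ, true_and] at hk hk'
      linarith [hk'.1]
    unfold rodRank
    rw [h1, Finset.card_union_of_disjoint h2]; push_cast; ring
  have hpack := h.mul_card_Ico_lt ha hij
  unfold rodSpectator
  rw [hrank]
  nlinarith

/-- `X_i < X_j ↔ w_i < w_j`. [folklore] -/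
theorem lt_iff_rodSpectator_lt (h : RodTagged n L a s X) (ha : 0 ≤ a) (i j : Fin n) :
    X i < X j ↔ rodSpectator a X i < rodSpectator a X j := by
  constructor
  · exact h.rodSpectator_lt_of_lt ha
  · intro hw
    by_contra hij
    rcases lt_or_eq_of_le (not_lt.mp hij) with hji | hji
    · exact absurd (h.rodSpectator_lt_of_lt ha hji) (not_lt.mpr hw.le)
    · by_cases hij' : i = j
      · subst hij'; exact lt_irrefl _ hw
      · exact h.inj ha (Ne.symm hij') hji

/-- The spectator ranks are read off the compressed coordinates. [folklore] -/
theorem rodRank_rodSpectator (h : RodTagged n L a s X) (ha : 0 ≤ a) :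
    rodRank (rodSpectator a X) = rodRank X := by
  funext j
  unfold rodRank
  exact congrArg Finset.card (Finset.filter_congr fun i _ => (h.lt_iff_rodSpectator_lt ha i j).symm)

/-- The crossing count is read off the compressed coordinates. [folklore] -/
theorem crossedCount_eq_card_rodSpectator_le (h : RodTagged n L a s X) (ha : 0 ≤ a) :
    crossedCount X s = (Finset.univ.filter fun j : Fin n =>
      rodSpectator a X j ≤ s - a * crossedCount X s - a).card := by
  conv_lhs => unfold crossedCount
  exact congrArg Finset.card (Finset.filter_congr fun j _ => h.lt_iff_rodSpectator_le ha j)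

end RodTagged

/-! #### The tagged phase space and the excluded-volume map -/

/-- The **tagged phase space**: displacement `s ∈ (0, L)` of the second copy of the tagged rod and
strictly admissible spectators. [folklore] -/
def rodTaggedSet (n : ℕ) (L a : ℝ) : Set (ℝ × (Fin n → ℝ)) :=
  {p | p.1 ∈ Set.Ioo 0 L ∧ RodTagged n L a p.1 p.2}

/-- The **excluded-volume map** `Φ(s, X) = (s − ma, w)`. [cite: MazzantiEtAl2008, Eqs. (2)–(3)] -/
def rodExcludedVolumeMap (n : ℕ) (a : ℝ) (p : ℝ × (Fin n → ℝ)) : ℝ × (Fin n → ℝ) :=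
  (p.1 - a * crossedCount p.2 p.1, rodSpectator a p.2)

/-- The tagged phase space is open. [folklore] -/
theorem isOpen_rodTaggedSet (n : ℕ) (L a : ℝ) : IsOpen (rodTaggedSet n L a) := by
  rw [isOpen_iff_eventually]
  rintro p ⟨hp1, hp⟩
  have c1 : Continuous fun q : ℝ × (Fin n → ℝ) => q.1 := continuous_fst
  have cX : ∀ j : Fin n, Continuous fun q : ℝ × (Fin n → ℝ) => q.2 j :=
    fun j => (continuous_apply j).comp continuous_snd
  have e1 : ∀ᶠ q in 𝓝 p, q.1 ∈ Set.Ioo 0 L := c1.continuousAt.eventually_mem (isOpen_Ioo.mem_nhds hp1)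
  have eleft : ∀ᶠ q in 𝓝 p, ∀ j, a < q.2 j := eventually_all.2 fun j =>
    continuousAt_const.eventually_lt (cX j).continuousAt (hp.left j)
  have eright : ∀ᶠ q in 𝓝 p, ∀ j, q.2 j < L - a := eventually_all.2 fun j =>
    (cX j).continuousAt.eventually_lt continuousAt_const (hp.right j)
  have eaway : ∀ᶠ q in 𝓝 p, ∀ j, q.2 j < q.1 - a ∨ q.1 + a < q.2 j := eventually_all.2 fun j => by
    rcases hp.away j with h | h
    · exact ((cX j).continuousAt.eventually_lt (c1.sub continuous_const).continuousAt h).mono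
        fun q hq => Or.inl hq
    · exact ((c1.add continuous_const).continuousAt.eventually_lt (cX j).continuousAt h).mono
        fun q hq => Or.inr hq
  have esep : ∀ᶠ q in 𝓝 p, ∀ i j, i ≠ j → a < |q.2 i - q.2 j| :=
    eventually_all.2 fun i => eventually_all.2 fun j => by
      by_cases hij : i = j
      · exact Eventually.of_forall fun q h => absurd hij h
      · exact (continuousAt_const.eventually_lt ((cX i).sub (cX j)).abs.continuousAt
          (hp.sep i j hij)).mono fun q hq _ => hq
  filter_upwards [e1, eleft, eright, eaway, esep] with q h1 hl hr hw hs
  exact ⟨h1, ⟨hl, hr, hw, hs⟩⟩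

/-- The tagged phase space is measurable. [folklore] -/
theorem measurableSet_rodTaggedSet (n : ℕ) (L a : ℝ) : MeasurableSet (rodTaggedSet n L a) :=
  (isOpen_rodTaggedSet n L a).measurableSet

/-- **The order type is locally constant** on the tagged phase space: crossing count and ranks.
[folklore] -/
theorem eventually_counts_eq {p : ℝ × (Fin n → ℝ)} (hp : p ∈ rodTaggedSet n L a) (ha : 0 ≤ a) :
    ∀ᶠ q in 𝓝 p, crossedCount q.2 q.1 = crossedCount p.2 p.1 ∧ rodRank q.2 = rodRank p.2 := by
  obtain ⟨_, h⟩ := hp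
  have c1 : Continuous fun q : ℝ × (Fin n → ℝ) => q.1 := continuous_fst
  have cX : ∀ j : Fin n, Continuous fun q : ℝ × (Fin n → ℝ) => q.2 j :=
    fun j => (continuous_apply j).comp continuous_snd
  have eord : ∀ᶠ q in 𝓝 p, ∀ i j, (q.2 i < q.2 j ↔ p.2 i < p.2 j) :=
    eventually_all.2 fun i => eventually_all.2 fun j => by
      rcases lt_trichotomy (p.2 i) (p.2 j) with hlt | heq | hgt
      · exact ((cX i).continuousAt.eventually_lt (cX j).continuousAt hlt).mono
          fun q hq => iff_of_true hq hlt
      · have hij : i = j := by by_contra hij; exact h.inj ha hij heq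
        subst hij
        exact Eventually.of_forall fun q => by simp
      · exact ((cX j).continuousAt.eventually_lt (cX i).continuousAt hgt).mono fun q hq =>
          iff_of_false (not_lt.mpr hq.le) (not_lt.mpr hgt.le)
  have etag : ∀ᶠ q in 𝓝 p, ∀ j, (q.2 j < q.1 ↔ p.2 j < p.1) := eventually_all.2 fun j => by
    rcases lt_or_gt_of_ne (h.ne ha j) with hlt | hgt
    · exact ((cX j).continuousAt.eventually_lt c1.continuousAt hlt).mono fun q hq => iff_of_true hq hlt
    · exact (c1.continuousAt.eventually_lt (cX j).continuousAt hgt).mono fun q hq =>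
        iff_of_false (not_lt.mpr hq.le) (not_lt.mpr hgt.le)
  filter_upwards [eord, etag] with q hord htag
  refine ⟨?_, ?_⟩
  · unfold crossedCount
    exact congrArg Finset.card (Finset.filter_congr fun j _ => htag j)
  · funext j
    unfold rodRank
    exact congrArg Finset.card (Finset.filter_congr fun i _ => hord i j)

/-- **The excluded-volume map is locally a translation**: derivative `id` within the tagged phase
space. [folklore] -/
theorem hasFDerivWithinAt_rodExcludedVolumeMap {p : ℝ × (Fin n → ℝ)} (hp : p ∈ rodTaggedSet n L a)
    (ha : 0 ≤ a) :
    HasFDerivWithinAt (rodExcludedVolumeMap n a) (ContinuousLinearMap.id ℝ (ℝ × (Fin n → ℝ)))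
      (rodTaggedSet n L a) p := by
  set c : ℝ × (Fin n → ℝ) := (a * crossedCount p.2 p.1, fun j => a * (1 + rodRank p.2 j)) with hc
  have hloc : rodExcludedVolumeMap n a =ᶠ[𝓝 p] fun q => q - c := by
    filter_upwards [eventually_counts_eq hp ha] with q hq
    obtain ⟨h1, h2⟩ := hq
    refine Prod.ext ?_ ?_
    · simp only [rodExcludedVolumeMap, Prod.fst_sub, hc, h1]
    · funext j
      simp only [rodExcludedVolumeMap, rodSpectator, Prod.snd_sub, Pi.sub_apply, hc, h2]
  exact ((hasFDerivAt_sub_const c).congr_of_eventuallyEq hloc).hasFDerivWithinAt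

/-- **The excluded-volume map is injective** on the tagged phase space. [folklore] -/
theorem injOn_rodExcludedVolumeMap (ha : 0 ≤ a) : Set.InjOn (rodExcludedVolumeMap n a) (rodTaggedSet n L a) := by
  rintro ⟨s, X⟩ ⟨_, hX⟩ ⟨s', X'⟩ ⟨_, hX'⟩ heq
  simp only [rodExcludedVolumeMap, Prod.mk.injEq] at heq
  obtain ⟨ht, hw⟩ := heq
  -- the spectators
  have hrank : rodRank X = rodRank X' := by
    rw [← hX.rodRank_rodSpectator ha, ← hX'.rodRank_rodSpectator ha, hw]
  have hXX : X = X' := by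
    funext j
    have := congrFun hw j
    simp only [rodSpectator] at this
    rw [hrank] at this
    linarith
  subst hXX
  -- the crossing count, then the displacement
  have hm : crossedCount X s = crossedCount X s' := by
    rw [hX.crossedCount_eq_card_rodSpectator_le ha, hX'.crossedCount_eq_card_rodSpectator_le ha, ht]
  have hs : s = s' := by rw [hm] at ht; linarith
  rw [hs]

/-- **The image lies in the compressed phase space**: `t = s − ma ∈ [0, L' + a]` and `w ∈ D_tⁿ`.
[folklore] -/
theorem rodExcludedVolumeMap_mem {p : ℝ × (Fin n → ℝ)} (hp : p ∈ rodTaggedSet n L a) (ha : 0 ≤ a) :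
    (rodExcludedVolumeMap n a p).1 ∈ Set.Icc 0 (L - ((n + 1 : ℕ) : ℝ) * a + a) ∧
      ∀ j, (rodExcludedVolumeMap n a p).2 j ∈
        rodDomain (L - ((n + 1 : ℕ) : ℝ) * a) a (rodExcludedVolumeMap n a p).1 := by
  obtain ⟨hp1, h⟩ := hp
  exact ⟨⟨h.crossed_nonneg ha hp1.1.le, h.crossed_le ha hp1.2.le⟩,
    fun j => h.rodSpectator_mem_rodDomain ha j⟩

/-! #### A uniform bound on the Girardeau and rod states -/

/-- The crude uniform bound `|ψ_N| ≤ (N! L^N)^{-1/2} 2^{N²}`. [folklore] -/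
theorem abs_girardeauState_le (N : ℕ) (L : ℝ) (Y : Fin N → ℝ) :
    |girardeauState N L Y| ≤ (Real.sqrt (N.factorial * L ^ N))⁻¹ * 2 ^ (N * N) := by
  rw [abs_of_nonneg (girardeauState_nonneg _ _ _)]
  unfold girardeauState
  refine mul_le_mul_of_nonneg_left ?_ (inv_nonneg.mpr (Real.sqrt_nonneg _))
  calc ∏ j : Fin N, ∏ k : Fin N with j < k, 2 * |Real.sin (Real.pi * (Y k - Y j) / L)|
      ≤ ∏ j : Fin N, ∏ k : Fin N with j < k, (2 : ℝ) := by
        refine Finset.prod_le_prod (fun j _ => Finset.prod_nonneg fun k _ => by positivity)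
          fun j _ => Finset.prod_le_prod (fun k _ => by positivity) fun k _ => ?_
        have := Real.abs_sin_le_one (Real.pi * (Y k - Y j) / L)
        linarith
    _ ≤ ∏ _j : Fin N, (2 : ℝ) ^ N := by
        refine Finset.prod_le_prod (fun j _ => Finset.prod_nonneg fun k _ => by positivity)
          fun j _ => ?_
        rw [Finset.prod_const]
        exact pow_le_pow_right₀ (by norm_num) ((Finset.card_filter_le _ _).trans (by simp))
    _ = 2 ^ (N * N) := by
        rw [Finset.prod_const, Finset.card_univ, Fintype.card_fin, ← pow_mul]

/-- The corresponding uniform bound on the rod state. [folklore] -/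
theorem rodState_le (N : ℕ) (L a : ℝ) (x : Fin N → ℝ) :
    rodState N L a x ≤ Real.sqrt ((L - N * a) / L) *
      ((Real.sqrt (N.factorial * (L - N * a) ^ N))⁻¹ * 2 ^ (N * N)) := by
  unfold rodState Set.indicator
  refine mul_le_mul_of_nonneg_left ?_ (Real.sqrt_nonneg _)
  split_ifs
  · exact (le_abs_self _).trans (abs_girardeauState_le _ _ _)
  · positivity

/-! #### The two integrands on the tagged phase space -/

/-- The two-point rod integrand `F(s, X) = Ψ(X, 0) Ψ(X, s)` on the tagged phase space.
[cite: MazzantiEtAl2008, p. 3] -/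
def rodPairFun (n : ℕ) (L a : ℝ) (p : ℝ × (Fin n → ℝ)) : ℝ :=
  rodState (n + 1) L a (Fin.snoc p.2 0) * rodState (n + 1) L a (Fin.snoc p.2 p.1)

/-- The compressed two-point Girardeau integrand `G(t, w) = Ψ_TG(w, 0) Ψ_TG(T_t w, t)`.
[cite: MazzantiEtAl2008, Eqs. (2)–(3)] -/
def rodCompressedPairFun (n : ℕ) (Lp a : ℝ) (q : ℝ × (Fin n → ℝ)) : ℝ :=
  girardeauState (n + 1) Lp (Fin.snoc q.2 0) *
    girardeauState (n + 1) Lp (Fin.snoc (fun i => rodShift a q.1 (q.2 i)) q.1)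

/-- `F ≥ 0`. [folklore] -/
theorem rodPairFun_nonneg (n : ℕ) (L a : ℝ) (p : ℝ × (Fin n → ℝ)) : 0 ≤ rodPairFun n L a p :=
  mul_nonneg (rodState_nonneg _ _ _ _) (rodState_nonneg _ _ _ _)

/-- `G ≥ 0`. [folklore] -/
theorem rodCompressedPairFun_nonneg (n : ℕ) (Lp a : ℝ) (q : ℝ × (Fin n → ℝ)) :
    0 ≤ rodCompressedPairFun n Lp a q :=
  mul_nonneg (girardeauState_nonneg _ _ _) (girardeauState_nonneg _ _ _)

/-- `F` is bounded. [folklore] -/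
theorem rodPairFun_le (n : ℕ) (L a : ℝ) (p : ℝ × (Fin n → ℝ)) :
    rodPairFun n L a p ≤ (Real.sqrt ((L - (n + 1 : ℕ) * a) / L) *
      ((Real.sqrt ((n + 1).factorial * (L - (n + 1 : ℕ) * a) ^ (n + 1)))⁻¹ * 2 ^ ((n + 1) * (n + 1)))) ^ 2 := by
  unfold rodPairFun
  rw [sq]
  exact mul_le_mul (rodState_le _ _ _ _) (rodState_le _ _ _ _) (rodState_nonneg _ _ _ _)
    ((rodState_nonneg (n + 1) L a (Fin.snoc p.2 0)).trans (rodState_le _ _ _ _))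

/-- `G` is bounded. [folklore] -/
theorem rodCompressedPairFun_le (n : ℕ) (Lp a : ℝ) (q : ℝ × (Fin n → ℝ)) :
    rodCompressedPairFun n Lp a q ≤
      ((Real.sqrt ((n + 1).factorial * Lp ^ (n + 1)))⁻¹ * 2 ^ ((n + 1) * (n + 1))) ^ 2 := by
  unfold rodCompressedPairFun
  rw [sq]
  exact mul_le_mul ((le_abs_self _).trans (abs_girardeauState_le _ _ _))
    ((le_abs_self _).trans (abs_girardeauState_le _ _ _)) (girardeauState_nonneg _ _ _)
    ((abs_nonneg (girardeauState (n + 1) Lp (Fin.snoc q.2 0))).trans (abs_girardeauState_le _ _ _))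

/-- `F` is measurable. [folklore] -/
theorem measurable_rodPairFun (n : ℕ) (L a : ℝ) : Measurable (rodPairFun n L a) := by
  unfold rodPairFun
  exact ((measurable_rodState (n + 1) L a).comp ((continuous_snoc_const 0).comp continuous_snd).measurable).mul
    ((measurable_rodState (n + 1) L a).comp
      (Continuous.finSnoc (A := fun _ : Fin (n + 1) => ℝ) continuous_snd continuous_fst).measurable)

/-- `G` is measurable (the rod shift is piecewise a translation). [folklore] -/
theorem measurable_rodCompressedPairFun (n : ℕ) (Lp a : ℝ) : Measurable (rodCompressedPairFun n Lp a) := by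
  have h1 : Measurable fun q : ℝ × (Fin n → ℝ) => (Fin.snoc q.2 0 : Fin (n + 1) → ℝ) :=
    ((continuous_snoc_const 0).comp continuous_snd).measurable
  have h2 : Measurable fun q : ℝ × (Fin n → ℝ) =>
      (Fin.snoc (fun i => rodShift a q.1 (q.2 i)) q.1 : Fin (n + 1) → ℝ) := by
    refine measurable_pi_iff.mpr fun k => ?_
    refine Fin.lastCases ?_ (fun i => ?_) k
    · simp only [Fin.snoc_last]; exact measurable_fst
    · simp only [Fin.snoc_castSucc]
      unfold rodShift
      have ci : Measurable fun q : ℝ × (Fin n → ℝ) => q.2 i := (measurable_pi_apply i).comp measurable_snd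
      exact Measurable.ite (measurableSet_le ci (measurable_fst.sub_const a)) (ci.add_const a) ci
  unfold rodCompressedPairFun
  exact ((continuous_girardeauState _ _).measurable.comp h1).mul
    ((continuous_girardeauState _ _).measurable.comp h2)

/-! #### The boundary null set and the vanishing of `F` off the tagged phase space -/

/-- A level set of a non-zero linear functional is a null set for an additive Haar measure.
[folklore] -/
theorem addHaar_linearLevelSet_eq_zero {E : Type*} [NormedAddCommGroup E] [NormedSpace ℝ E]
    [MeasurableSpace E] [BorelSpace E] [FiniteDimensional ℝ E] (μ : Measure E) [μ.IsAddHaarMeasure]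
    (ℓ : E →ₗ[ℝ] ℝ) {v : E} (hv : ℓ v ≠ 0) (c : ℝ) : μ {p | ℓ p = c} = 0 := by
  by_cases hne : ∃ p₀, ℓ p₀ = c
  · obtain ⟨p₀, hp₀⟩ := hne
    set S : AffineSubspace ℝ E := AffineSubspace.mk' p₀ (LinearMap.ker ℓ) with hS
    have hcoe : (S : Set E) = {p | ℓ p = c} := by
      ext p
      simp only [hS, SetLike.mem_coe, AffineSubspace.mem_mk', vsub_eq_sub, LinearMap.mem_ker, map_sub,
        Set.mem_setOf_eq, hp₀, sub_eq_zero]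
    have htop : S ≠ ⊤ := by
      intro htop
      have hmem : p₀ + v ∈ S := by rw [htop]; exact AffineSubspace.mem_top ℝ E _
      rw [← SetLike.mem_coe, hcoe, Set.mem_setOf_eq, map_add, hp₀] at hmem
      exact hv (by linarith)
    rw [← hcoe]
    exact Measure.addHaar_affineSubspace μ S htop
  · have : {p : E | ℓ p = c} = ∅ := Set.eq_empty_iff_forall_notMem.mpr fun p hp => hne ⟨p, hp⟩
    rw [this, measure_empty]

/-- The **boundary set** of the tagged phase space: a displacement at `0` or `L`, a spectator at
`a` or `L − a`, a spectator exactly `a` from the tagged rod at `s`, or two spectators exactly `a`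
apart — a finite union of hyperplanes. [folklore] -/
def rodBoundarySet (n : ℕ) (L a : ℝ) : Set (ℝ × (Fin n → ℝ)) :=
  ({p | p.1 = 0} ∪ {p | p.1 = L}) ∪ ⋃ j : Fin n,
    (((({p | p.2 j = a} ∪ {p | p.2 j = L - a}) ∪ {p | p.2 j - p.1 = a}) ∪ {p | p.2 j - p.1 = -a}) ∪
      ⋃ i : Fin n, {p | i ≠ j ∧ p.2 i - p.2 j = a})

/-- The boundary set is Lebesgue-null. [folklore] -/
theorem volume_rodBoundarySet_eq_zero (n : ℕ) (L a : ℝ) :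
    ((volume : Measure ℝ).prod (volume : Measure (Fin n → ℝ))) (rodBoundarySet n L a) = 0 := by
  set μ : Measure (ℝ × (Fin n → ℝ)) := (volume : Measure ℝ).prod (volume : Measure (Fin n → ℝ)) with hμ
  set ℓ₁ : (ℝ × (Fin n → ℝ)) →ₗ[ℝ] ℝ := LinearMap.fst ℝ ℝ (Fin n → ℝ) with hℓ₁
  set ℓX : Fin n → (ℝ × (Fin n → ℝ)) →ₗ[ℝ] ℝ :=
    fun j => (LinearMap.proj j).comp (LinearMap.snd ℝ ℝ (Fin n → ℝ)) with hℓX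
  have h1 : ∀ c, μ {p : ℝ × (Fin n → ℝ) | p.1 = c} = 0 := fun c => by
    simpa [hℓ₁] using addHaar_linearLevelSet_eq_zero μ ℓ₁ (v := (1, 0)) (by simp [hℓ₁]) c
  have h2 : ∀ j c, μ {p : ℝ × (Fin n → ℝ) | p.2 j = c} = 0 := fun j c => by
    simpa [hℓX] using addHaar_linearLevelSet_eq_zero μ (ℓX j) (v := (0, fun _ => 1)) (by simp [hℓX]) c
  have h3 : ∀ j c, μ {p : ℝ × (Fin n → ℝ) | p.2 j - p.1 = c} = 0 := fun j c => by
    simpa [hℓX, hℓ₁] using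
      addHaar_linearLevelSet_eq_zero μ (ℓX j - ℓ₁) (v := (0, fun _ => 1)) (by simp [hℓX, hℓ₁]) c
  have h4 : ∀ i j, i ≠ j → ∀ c, μ {p : ℝ × (Fin n → ℝ) | p.2 i - p.2 j = c} = 0 := fun i j hij c => by
    simpa [hℓX] using addHaar_linearLevelSet_eq_zero μ (ℓX i - ℓX j) (v := (0, Pi.single i 1))
      (by simp [hℓX, Pi.single_eq_of_ne (Ne.symm hij)]) c
  refine measure_union_null (measure_union_null (h1 0) (h1 L)) (measure_iUnion_null fun j => ?_)
  refine measure_union_null (measure_union_null (measure_union_null (measure_union_null (h2 j a)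
    (h2 j (L - a))) (h3 j a)) (h3 j (-a))) (measure_iUnion_null fun i => ?_)
  by_cases hij : i = j
  · have : {p : ℝ × (Fin n → ℝ) | i ≠ j ∧ p.2 i - p.2 j = a} = ∅ := by
      ext p; simp [hij]
    rw [this]; exact measure_empty
  · have : {p : ℝ × (Fin n → ℝ) | i ≠ j ∧ p.2 i - p.2 j = a} = {p | p.2 i - p.2 j = a} := by
      ext p; simp [hij]
    rw [this]; exact h4 i j hij a

/-- A cyclic distance below the rod length breaks admissibility of a tagged configuration
(spectator versus the tagged point). [folklore] -/
theorem not_rodAdmissible_snoc_of_lt {X : Fin n → ℝ} {c : ℝ} (j : Fin n) (h : ringDist L (X j) c < a) :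
    ¬ rodAdmissible L a (Fin.snoc X c : Fin (n + 1) → ℝ) := by
  intro hadm
  have := hadm (Fin.castSucc j) (Fin.last n) (Fin.castSucc_lt_last j).ne
  simp only [Fin.snoc_castSucc, Fin.snoc_last] at this
  linarith

/-- Two spectators closer than the rod length break admissibility. [folklore] -/
theorem not_rodAdmissible_snoc_of_lt' {X : Fin n → ℝ} (c : ℝ) {i j : Fin n} (hij : i ≠ j)
    (h : ringDist L (X i) (X j) < a) : ¬ rodAdmissible L a (Fin.snoc X c : Fin (n + 1) → ℝ) := by
  intro hadm
  have := hadm (Fin.castSucc i) (Fin.castSucc j) (fun h' => hij (Fin.castSucc_injective _ h'))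
  simp only [Fin.snoc_castSucc] at this
  linarith

/-- **`F` vanishes off the tagged phase space, up to the boundary null set** (inside the box).
[folklore] -/
theorem rodPairFun_eq_zero {p : ℝ × (Fin n → ℝ)}
    (hB : p ∈ Set.Icc 0 L ×ˢ Set.pi Set.univ (fun _ : Fin n => Set.Icc (0 : ℝ) L))
    (hU : p ∉ rodTaggedSet n L a) (hN : p ∉ rodBoundarySet n L a) : rodPairFun n L a p = 0 := by
  obtain ⟨hs, hX⟩ := hB
  have hX' : ∀ j, p.2 j ∈ Set.Icc (0 : ℝ) L := fun j => hX j (Set.mem_univ _)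
  -- consequences of avoiding the boundary set
  have nb : ∀ {P : Prop}, (P → p ∈ rodBoundarySet n L a) → ¬P := fun himp hP => hN (himp hP)
  have hs0 : p.1 ≠ 0 := nb fun h => Or.inl (Or.inl h)
  have hsL : p.1 ≠ L := nb fun h => Or.inl (Or.inr h)
  have hja : ∀ j, p.2 j ≠ a := fun j =>
    nb fun h => Or.inr (Set.mem_iUnion.mpr ⟨j, Or.inl (Or.inl (Or.inl (Or.inl h)))⟩)
  have hjLa : ∀ j, p.2 j ≠ L - a := fun j =>
    nb fun h => Or.inr (Set.mem_iUnion.mpr ⟨j, Or.inl (Or.inl (Or.inl (Or.inr h)))⟩)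
  have hjs : ∀ j, p.2 j - p.1 ≠ a := fun j =>
    nb fun h => Or.inr (Set.mem_iUnion.mpr ⟨j, Or.inl (Or.inl (Or.inr h))⟩)
  have hjs' : ∀ j, p.2 j - p.1 ≠ -a := fun j =>
    nb fun h => Or.inr (Set.mem_iUnion.mpr ⟨j, Or.inl (Or.inr h)⟩)
  have hij : ∀ i j, i ≠ j → p.2 i - p.2 j ≠ a := fun i j hne =>
    nb fun h => Or.inr (Set.mem_iUnion.mpr ⟨j, Or.inr (Set.mem_iUnion.mpr ⟨i, ⟨hne, h⟩⟩)⟩)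
  have hs_pos : 0 < p.1 := lt_of_le_of_ne hs.1 (Ne.symm hs0)
  have hs_lt : p.1 < L := lt_of_le_of_ne hs.2 hsL
  -- the vanishing factors
  have zero_snd : ¬ rodAdmissible L a (Fin.snoc p.2 p.1 : Fin (n + 1) → ℝ) → rodPairFun n L a p = 0 :=
    fun h => by unfold rodPairFun; rw [rodState_eq_zero_of_not_admissible L a h, mul_zero]
  have zero_fst' : ¬ rodAdmissible L a (Fin.snoc p.2 0 : Fin (n + 1) → ℝ) → rodPairFun n L a p = 0 :=
    fun h => by unfold rodPairFun; rw [rodState_eq_zero_of_not_admissible L a h, zero_mul]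
  by_contra hF
  apply hU
  refine ⟨⟨hs_pos, hs_lt⟩, ⟨fun j => ?_, fun j => ?_, fun j => ?_, fun i j hne => ?_⟩⟩
  · by_contra hle
    push Not at hle
    have hlt : p.2 j < a := lt_of_le_of_ne hle (hja j)
    refine hF (zero_fst' (not_rodAdmissible_snoc_of_lt j ?_))
    calc ringDist L (p.2 j) 0 ≤ |p.2 j - 0| := min_le_left _ _
      _ = p.2 j := by rw [sub_zero, abs_of_nonneg (hX' j).1]
      _ < a := hlt
  · by_contra hge
    push Not at hge
    have hgt : L - a < p.2 j := lt_of_le_of_ne hge (Ne.symm (hjLa j))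
    refine hF (zero_fst' (not_rodAdmissible_snoc_of_lt j ?_))
    calc ringDist L (p.2 j) 0 ≤ L - |p.2 j - 0| := min_le_right _ _
      _ = L - p.2 j := by rw [sub_zero, abs_of_nonneg (hX' j).1]
      _ < a := by linarith
  · by_contra hno
    push Not at hno
    have habs : |p.2 j - p.1| < a :=
      abs_lt.mpr ⟨lt_of_le_of_ne (by linarith [hno.1]) (Ne.symm (hjs' j)),
        lt_of_le_of_ne (by linarith [hno.2]) (hjs j)⟩
    refine hF (zero_snd (not_rodAdmissible_snoc_of_lt j ?_))
    exact lt_of_le_of_lt (min_le_left _ _) habs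
  · by_contra hle
    push Not at hle
    have h1 := hij i j hne
    have h2 := hij j i (Ne.symm hne)
    have habs : |p.2 i - p.2 j| < a := by
      refine abs_lt.mpr ⟨lt_of_le_of_ne ?_ ?_, lt_of_le_of_ne ?_ h1⟩
      · linarith [neg_abs_le (p.2 i - p.2 j)]
      · intro h; apply h2; linarith
      · exact le_abs_self _ |>.trans hle
    refine hF (zero_fst' (not_rodAdmissible_snoc_of_lt' 0 hne ?_))
    exact lt_of_le_of_lt (min_le_left _ _) habs

/-! #### The compressed phase space and Tonelli -/

/-- The **compressed phase space** `V = {(t, w) : t ∈ [0, L' + a], w ∈ D_tⁿ}`. [folklore] -/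
def rodCompressedSet (n : ℕ) (Lp a : ℝ) : Set (ℝ × (Fin n → ℝ)) :=
  {q | q.1 ∈ Set.Icc 0 (Lp + a) ∧ ∀ j, q.2 j ∈ rodDomain Lp a q.1}

/-- `V` is measurable. [folklore] -/
theorem measurableSet_rodCompressedSet (n : ℕ) (Lp a : ℝ) : MeasurableSet (rodCompressedSet n Lp a) := by
  have h1 : MeasurableSet {q : ℝ × (Fin n → ℝ) | q.1 ∈ Set.Icc 0 (Lp + a)} :=
    measurableSet_Icc.preimage measurable_fst
  have h2 : ∀ j, MeasurableSet {q : ℝ × (Fin n → ℝ) | q.2 j ∈ rodDomain Lp a q.1} := by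
    intro j
    have cj : Measurable fun q : ℝ × (Fin n → ℝ) => q.2 j := (measurable_pi_apply j).comp measurable_snd
    have : {q : ℝ × (Fin n → ℝ) | q.2 j ∈ rodDomain Lp a q.1} =
        ({q | 0 ≤ q.2 j} ∩ {q | q.2 j ≤ q.1 - a}) ∪ ({q | q.1 < q.2 j} ∩ {q | q.2 j ≤ Lp}) := by
      ext q
      simp only [rodDomain, Set.mem_setOf_eq, Set.mem_union, Set.mem_Icc, Set.mem_Ioc, Set.mem_inter_iff]
    rw [this]
    exact ((measurableSet_le measurable_const cj).inter (measurableSet_le cj (measurable_fst.sub_const a))).union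
      ((measurableSet_lt measurable_fst cj).inter (measurableSet_le cj measurable_const))
  have : rodCompressedSet n Lp a =
      {q | q.1 ∈ Set.Icc 0 (Lp + a)} ∩ ⋂ j, {q | q.2 j ∈ rodDomain Lp a q.1} := by
    ext q; simp [rodCompressedSet]
  rw [this]
  exact h1.inter (MeasurableSet.iInter h2)

/-- **Tonelli on the compressed phase space**: `∫_V g = ∫₀^{L'+a} ∫_{D_tⁿ} g(t, w) dw dt`. [folklore] -/
theorem lintegral_rodCompressedSet (Lp a : ℝ) {g : ℝ × (Fin n → ℝ) → ℝ≥0∞} (hg : Measurable g) :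
    ∫⁻ q in rodCompressedSet n Lp a, g q ∂((volume : Measure ℝ).prod (volume : Measure (Fin n → ℝ))) =
      ∫⁻ t in Set.Icc 0 (Lp + a), ∫⁻ w in Set.pi Set.univ (fun _ : Fin n => rodDomain Lp a t), g (t, w) := by
  rw [← lintegral_indicator (measurableSet_rodCompressedSet n Lp a),
    lintegral_prod _ ((hg.indicator (measurableSet_rodCompressedSet n Lp a)).aemeasurable),
    ← lintegral_indicator measurableSet_Icc]
  congr 1
  funext t
  by_cases ht : t ∈ Set.Icc 0 (Lp + a)
  · rw [Set.indicator_of_mem ht,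
      ← lintegral_indicator (MeasurableSet.univ_pi fun _ => measurableSet_rodDomain Lp a t)]
    congr 1
    funext w
    by_cases hw : w ∈ Set.pi Set.univ (fun _ : Fin n => rodDomain Lp a t)
    · rw [Set.indicator_of_mem hw, Set.indicator_of_mem]
      exact ⟨ht, fun j => hw j (Set.mem_univ _)⟩
    · rw [Set.indicator_of_notMem hw, Set.indicator_of_notMem]
      rintro ⟨_, h⟩
      exact hw fun j _ => h j
  · rw [Set.indicator_of_notMem ht]
    have h0 : ∀ w : Fin n → ℝ, (rodCompressedSet n Lp a).indicator g (t, w) = 0 := fun w =>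
      Set.indicator_of_notMem (fun h => ht h.1) _
    simp [h0]

/-- The inner integral is the compressed density: `∫_{D_tⁿ} G(t, w) dw = ρ̃(t)/(n+1)`. [folklore] -/
theorem integral_rodCompressedPairFun (n : ℕ) (Lp a t : ℝ) :
    ∫ w in Set.pi Set.univ (fun _ : Fin n => rodDomain Lp a t), rodCompressedPairFun n Lp a (t, w) =
      rodCompressedDensity n Lp a t / (n + 1) := by
  unfold rodCompressedDensity rodCompressedPairFun
  rw [mul_div_cancel_left₀ _ (by positivity : (n + 1 : ℝ) ≠ 0)]

/-- `G(t, ·)` is integrable on `D_tⁿ`. [folklore] -/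
theorem integrableOn_rodCompressedPairFun (n : ℕ) (Lp a t : ℝ) :
    IntegrableOn (fun w => rodCompressedPairFun n Lp a (t, w))
      (Set.pi Set.univ (fun _ : Fin n => rodDomain Lp a t)) volume := by
  have hD : volume (rodDomain Lp a t) < ⊤ := by
    rw [← Measure.restrict_apply_univ]; exact measure_lt_top _ _
  refine IntegrableOn.of_bound (volume_pi_lt_top hD)
    (((measurable_rodCompressedPairFun n Lp a).comp measurable_prodMk_left).aestronglyMeasurable)
    (((Real.sqrt ((n + 1).factorial * Lp ^ (n + 1)))⁻¹ * 2 ^ ((n + 1) * (n + 1))) ^ 2)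
    (Eventually.of_forall fun w => ?_)
  rw [Real.norm_eq_abs, abs_of_nonneg (rodCompressedPairFun_nonneg _ _ _ _)]
  exact rodCompressedPairFun_le _ _ _ _

/-- The inner Lebesgue integral: `∫⁻_{D_tⁿ} G(t, w) dw = ρ̃(t)/(n+1)`. [folklore] -/
theorem lintegral_rodCompressedPairFun (n : ℕ) (Lp a t : ℝ) :
    ∫⁻ w in Set.pi Set.univ (fun _ : Fin n => rodDomain Lp a t),
        ENNReal.ofReal (rodCompressedPairFun n Lp a (t, w)) =
      ENNReal.ofReal (rodCompressedDensity n Lp a t / (n + 1)) := by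
  rw [← integral_rodCompressedPairFun,
    ofReal_integral_eq_lintegral_ofReal (integrableOn_rodCompressedPairFun n Lp a t)
      (Eventually.of_forall fun w => rodCompressedPairFun_nonneg _ _ _ _)]

/-! #### The change of variables -/

/-- **The excluded-volume change of variables** (Lebesgue-integral form):
`∫_{[0,L]×[0,L]ⁿ} Ψ(X,0)Ψ(X,s) dX ds ≤ (L'/L) ∫_V Ψ_TG(w,0)Ψ_TG(T_t w,t) dw dt` — equality off the
boundary null set onto the image, then monotonicity in the domain.
[cite: MazzantiEtAl2008, Eqs. (2)–(3)] -/
theorem lintegral_rodPairFun_le (hL : 0 < L) (ha : 0 ≤ a) (hLp : 0 ≤ L - ((n + 1 : ℕ) : ℝ) * a) :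
    ∫⁻ p in Set.Icc 0 L ×ˢ Set.pi Set.univ (fun _ : Fin n => Set.Icc (0 : ℝ) L),
        ENNReal.ofReal (rodPairFun n L a p) ∂((volume : Measure ℝ).prod (volume : Measure (Fin n → ℝ))) ≤
      ENNReal.ofReal ((L - ((n + 1 : ℕ) : ℝ) * a) / L) *
        ∫⁻ q in rodCompressedSet n (L - ((n + 1 : ℕ) : ℝ) * a) a,
          ENNReal.ofReal (rodCompressedPairFun n (L - ((n + 1 : ℕ) : ℝ) * a) a q)
            ∂((volume : Measure ℝ).prod (volume : Measure (Fin n → ℝ))) := by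
  set μ : Measure (ℝ × (Fin n → ℝ)) := (volume : Measure ℝ).prod (volume : Measure (Fin n → ℝ)) with hμ
  set Lp := L - ((n + 1 : ℕ) : ℝ) * a with hLpdef
  set B := Set.Icc 0 L ×ˢ Set.pi Set.univ (fun _ : Fin n => Set.Icc (0 : ℝ) L) with hB
  set U := rodTaggedSet n L a with hU
  set f : ℝ × (Fin n → ℝ) → ℝ≥0∞ := fun p => ENNReal.ofReal (rodPairFun n L a p) with hf
  set g : ℝ × (Fin n → ℝ) → ℝ≥0∞ := fun q => ENNReal.ofReal (rodCompressedPairFun n Lp a q) with hg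
  have hBm : MeasurableSet B := measurableSet_Icc.prod (MeasurableSet.univ_pi fun _ => measurableSet_Icc)
  have hUm : MeasurableSet U := measurableSet_rodTaggedSet n L a
  have hUB : U ⊆ B := by
    rintro ⟨s, X⟩ ⟨hs, hX⟩
    exact ⟨⟨hs.1.le, hs.2.le⟩, fun j _ => ⟨(lt_of_le_of_lt ha (hX.left j)).le, by linarith [hX.right j]⟩⟩
  -- Step 1: restrict to the tagged phase space
  have hstep1 : ∫⁻ p in B, f p ∂μ = ∫⁻ p in U, f p ∂μ := by
    have hae : ∀ᵐ p ∂μ, p ∉ rodBoundarySet n L a :=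
      measure_eq_zero_iff_ae_notMem.mp (volume_rodBoundarySet_eq_zero n L a)
    have hcongr : ∀ᵐ p ∂(μ.restrict B), f p = U.indicator f p := by
      rw [ae_restrict_iff' hBm]
      filter_upwards [hae] with p hpN hpB
      by_cases hpU : p ∈ U
      · rw [Set.indicator_of_mem hpU]
      · rw [Set.indicator_of_notMem hpU, hf]
        show ENNReal.ofReal (rodPairFun n L a p) = 0
        rw [rodPairFun_eq_zero hpB hpU hpN, ENNReal.ofReal_zero]
    rw [lintegral_congr_ae hcongr, lintegral_indicator hUm, Measure.restrict_restrict hUm,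
      Set.inter_eq_left.mpr hUB]
  -- Step 2: the pointwise identity and the change of variables onto the image
  have hdet : (ContinuousLinearMap.id ℝ (ℝ × (Fin n → ℝ))).det = 1 := by
    simp only [ContinuousLinearMap.det, ContinuousLinearMap.coe_id, LinearMap.det_id]
  have hstep2 : ∫⁻ p in U, f p ∂μ = ENNReal.ofReal (Lp / L) * ∫⁻ q in rodExcludedVolumeMap n a '' U, g q ∂μ := by
    rw [lintegral_image_eq_lintegral_abs_det_fderiv_mul μ hUm
      (fun p hp => hasFDerivWithinAt_rodExcludedVolumeMap hp ha) (injOn_rodExcludedVolumeMap ha) g,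
      ← lintegral_const_mul' _ _ ENNReal.ofReal_ne_top]
    refine setLIntegral_congr_fun hUm fun p hp => ?_
    rw [hdet, abs_one, ENNReal.ofReal_one, one_mul, hf, hg]
    show ENNReal.ofReal (rodPairFun n L a p) =
      ENNReal.ofReal (Lp / L) * ENNReal.ofReal (rodCompressedPairFun n Lp a (rodExcludedVolumeMap n a p))
    rw [← ENNReal.ofReal_mul (div_nonneg hLp hL.le)]
    congr 1
    obtain ⟨hp1, h⟩ := hp
    simp only [rodPairFun, rodCompressedPairFun, rodExcludedVolumeMap]
    exact h.rodState_snoc_mul_rodState_snoc hL ha hLp hp1.1.le hp1.2.le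
  -- Step 3: monotonicity in the domain
  have hstep3 : ∫⁻ q in rodExcludedVolumeMap n a '' U, g q ∂μ ≤ ∫⁻ q in rodCompressedSet n Lp a, g q ∂μ := by
    refine lintegral_mono_set ?_
    rintro _ ⟨p, hp, rfl⟩
    exact rodExcludedVolumeMap_mem hp ha
  rw [hstep1, hstep2]
  gcongr

/-- **The excluded-volume bound on the displacement integral**:
`∫_{[0,L]×[0,L]ⁿ} Ψ(X,0)Ψ(X,s) ≤ (L'/L) ∫₀^{L'+a} ρ̃(t)/(n+1) dt` (Lebesgue integrals).
[cite: MazzantiEtAl2008, Eqs. (2)–(3)] -/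
theorem lintegral_rodPairFun_le_lintegral_density (hL : 0 < L) (ha : 0 ≤ a)
    (hLp : 0 ≤ L - ((n + 1 : ℕ) : ℝ) * a) :
    ∫⁻ p in Set.Icc 0 L ×ˢ Set.pi Set.univ (fun _ : Fin n => Set.Icc (0 : ℝ) L),
        ENNReal.ofReal (rodPairFun n L a p) ∂((volume : Measure ℝ).prod (volume : Measure (Fin n → ℝ))) ≤
      ENNReal.ofReal ((L - ((n + 1 : ℕ) : ℝ) * a) / L) *
        ∫⁻ t in Set.Icc 0 (L - ((n + 1 : ℕ) : ℝ) * a + a),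
          ENNReal.ofReal (rodCompressedDensity n (L - ((n + 1 : ℕ) : ℝ) * a) a t / (n + 1)) := by
  refine (lintegral_rodPairFun_le hL ha hLp).trans (le_of_eq ?_)
  congr 1
  rw [lintegral_rodCompressedSet _ _ (measurable_rodCompressedPairFun _ _ _).ennreal_ofReal]
  refine setLIntegral_congr_fun measurableSet_Icc fun t _ => ?_
  exact lintegral_rodCompressedPairFun _ _ _ _

end Literature.Barriers.AtomisticToContinuum.BoseGas
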